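import Summits.ValiantsHypothesis.ValiantsHypothesis.Theorems.BarrierLeverAnchoredDoorHitsLowerPairsWApexRecursion
import Summits.ValiantsHypothesis.ValiantsHypothesis.Theorems.BarrierLeverAnchoredDoorHitsLowerPairsSplitGeneral
import Summits.ValiantsHypothesis.ValiantsHypothesis.Theorems.BarrierLeverAnchoredDoorHitsLowerPairsRelabel
import Summits.ValiantsHypothesis.ValiantsHypothesis.Theorems.BarrierLeverAnchoredDoorHitsLowerPairsLTRest
import Summits.ValiantsHypothesis.ValiantsHypothesis.Theorems.BarrierLeverAnchoredDoorHitsLowerPairsP2Reduction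
import Summits.ValiantsHypothesis.ValiantsHypothesis.Theorems.BarrierLeverAnchoredDoorHitsLowerPairsMoveThinResidual
import Summits.ValiantsHypothesis.ValiantsHypothesis.Theorems.BarrierLeverAnchoredDoorHitsLowerPairsMono

/-!
# Support item `AnchoredDoorHitsLowerPairs` (stmt-ValiantsHypothesis-22510), line `anchored-peeling`:
# CONJECTURE Z AS A NODE — the typed statement `Stmt.stub_conjZ` (the profile-2 dominant problem is «as nonsingular as its support»:
# NESTED HALL ⟹ some dominant matrix `p2Entry` is nonsingular), the kernel arrow Z ⟹ `symbolicDet 2 ≠ 0` (K1, p692620), and the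
# glued compositions through the residual of record

Helper file (`--supports stmt-ValiantsHypothesis-22510`; cell valiant-natproofs, rung V4, 𝒟-side door (c); registered line
`Cruxes/AnchoredDoorHitsLowerPairs/Lines/anchored_peeling.lean` v26 (planner p1 g23, RULING R33), registered residual of record
`Stmt.stub_ltRestNonCanonRSW` (p691725); prover seat val-np-p1 gen 26; memo HOME/val-np-p1/g25/MEMO-weighted-apex-valnp1-g25.md §11–§14
and HOME/val-np-p1/g26/MEMO-conjZ-node-valnp1-g26.md). Closes NO item.

WHAT.
1. `Stmt.stub_conjZ` — **CONJECTURE Z-door, typed over landed declarations (OFFERED STUB TEXT).** For every injective pair of simplicial complexes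
   `(u, w)` (rows, columns; equal size `r`) satisfying the PROFILE-2 NESTED HALL CONDITION
   `∀ d ≥ 1, #{j : 2d − 1 ≤ |w j|} ≤ #{i : d ≤ |u i|}` (equivalently `#{W : ⌈|W|/2⌉ ≥ d} ≤ #{U : |U| ≥ d}`), SOME complex anchor weights `Θ`
   and `x`-tails `Φ` make the dominant matrix `(P2.p2Entry Θ Φ (w j) (u i))_{i j}` of `…P2Reduction` nonsingular. (The dominant entry is
   `[x^U] Σ_{maximum matchings μ of W} ∏_{B ∈ μ} g_B` for the block doors `g_B = Σ_A Θ(A,B) x^A ∏_{b ∉ A}(1 + Φ(A,B) b · x_b)`; nested Hall is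
   NECESSARY since `[x^U] t_W = 0` whenever `|U| < ⌈|W|/2⌉`; numerics val-np-p1 g25: 0 singular among ≈ 3.2·10⁵ admissible pairs.)
   `Stmt.conjZGeneral` is the same for ARBITRARY families containing `∅` (memo §11, the natural generality of the x-elimination proof
   architecture §12); `stub_conjZ_of_general`.
2. `symbolicDet_two_ne_zero_of_conjZ` / `…_swap`: Z ⟹ `symbolicDet 2 h r u w ≠ 0` on every lower pair satisfying nested Hall in SOME orientation
   (K1 `P2.symbolicDet_two_ne_zero_of_p2Entry` + `symbolicDet_ne_zero_comm`), hence `symbolicDet s ≠ 0` for every `s ≥ 2` (`symbolicDet_ne_zero_mono`).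
3. **THE ORIENTATION LEMMA IS FALSE** (so Z alone does not give a sorry-free one-hypothesis composition): the lower pair
   `(3300 × Δ⁹, K₂₅₆^{(≤ 3)} + 579 484 tetrahedra)` (r = 3 375 901) fails profile-2 nested Hall in BOTH orientations, has NO thin vertex on either side
   and no star(2) step (memo g26 §1; the small example `(Δ⁶ ⊔ 104 points, tB(11,3))`, r = 232, already kills the «or thin-side» wording but has thin
   vertices). Hence Z enters the skeleton as a GLUED PAIR: this file types the complements
   `Stmt.stub_ltRestNonCanonRSWZ` (= the registered residual `Stmt.stub_ltRestNonCanonRSW` VERBATIM with `2 ≤ s` and two more hypotheses «nested Hall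
   fails in both orientations») and `Stmt.stub_moveThinRestZ` (= `Stmt.stub_moveThinResidual` of p623393 with `2 ≤ s` and the same two hypotheses), with
   the kernel glues `stub_ltRestNonCanonRSW_of_conjZ_rswz : stub_conjZ → stub_ltRestNonCanonRSWZ → stub_ltRestNonCanonRSW` and
   `stub_moveThinResidual_of_conjZ_restZ`, and the compositions BY NAME concluding the route decl
   (`anchoredDoorHitsLowerPairs_of_conjZ_rswz`, `anchoredDoorHitsLowerPairs_of_conjZ_moveThinRestZ`); on the way the Theorems-side chain
   `Stmt.stub_ltRestNonCanonRS → Stmt.stub_ltRest` (the skeleton's v22/v23 glue, with SP = theorem `stub_splitFamily` p686283 and DC up to relabelling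
   p654443) is recorded as `stub_ltRest_of_ltRestNonCanonRS`, so that `anchoredDoorHitsLowerPairs_of_ltRestNonCanonRS[W]` exist by name.

WHAT THIS IS NOT: Conjecture Z is NOT proved here (it is the offered node; its proof architecture is the x-elimination lemma, sequel files); no pair is
certified; nothing on crux stmt-ValiantsHypothesis-14610 or on `VP` versus `VNP`.
-/

set_option linter.dupNamespace false

namespace Summit.ValiantsHypothesis.ValiantsHypothesis.Theorems.BarrierLever.AnchoredPeeling

open Finset MvPolynomial

noncomputable section

/-! ## 1. The node: Conjecture Z (Z-door form, over `P2.p2Entry`) -/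

/-- **STUB TEXT (offered, v27 candidate) `stub_conjZ` = CONJECTURE Z-door on simplicial pairs.** For all `h, r` and every pair of injective
enumerations `u, w : Fin r → Finset (Fin h)` of simplicial complexes (lower sets) satisfying the profile-2 NESTED HALL condition
`∀ d ≥ 1, #{j : 2d − 1 ≤ |w j|} ≤ #{i : d ≤ |u i|}`, there are complex anchor weights `Θ` and `x`-tails `Φ` such that the profile-2 dominant matrix
`(P2.p2Entry Θ Φ (w j) (u i))_{i, j}` is nonsingular. WHY IT MIGHT FAIL: a nested-Hall-admissible lower pair on which EVERY choice of block doors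
leaves the maximum-matching matrix singular (none among ≈ 3.2·10⁵ tested pairs incl. 12 000 adversarial tight/star pairs at `n ≤ 7`, kit j324292;
the profile-1 analogue — products of vertex doors — IS false on non-lower families and characteristic-dependent). -/
def Stmt.stub_conjZ : Prop :=
  ∀ (h r : ℕ) (u w : Fin r → Finset (Fin h)), Function.Injective u → Function.Injective w →
    IsLowerSet (Set.range u) → IsLowerSet (Set.range w) →
    (∀ d : ℕ, 1 ≤ d →
      (Finset.univ.filter (fun j : Fin r => 2 * d - 1 ≤ (w j).card)).card ≤
        (Finset.univ.filter (fun i : Fin r => d ≤ (u i).card)).card) →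
    ∃ (Θ : Finset (Fin h) × Finset (Fin h) → ℂ) (Φ : Finset (Fin h) × Finset (Fin h) → Fin h → ℂ),
      (Matrix.of fun i j : Fin r => P2.p2Entry Θ Φ (w j) (u i)).det ≠ 0

/-- **CONJECTURE Z-door for ARBITRARY families (memo §11, the generality in which the x-elimination architecture §12 runs):** injective `u, w`
of equal size, BOTH containing `∅`, nested Hall ⟹ some dominant matrix is nonsingular. (Both `∅`'s are needed: the `∅`-column of the dominant
matrix is the unit vector at the `∅`-row.) -/
def Stmt.conjZGeneral : Prop :=
  ∀ (h r : ℕ) (u w : Fin r → Finset (Fin h)), Function.Injective u → Function.Injective w →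
    (∃ i, u i = ∅) → (∃ j, w j = ∅) →
    (∀ d : ℕ, 1 ≤ d →
      (Finset.univ.filter (fun j : Fin r => 2 * d - 1 ≤ (w j).card)).card ≤
        (Finset.univ.filter (fun i : Fin r => d ≤ (u i).card)).card) →
    ∃ (Θ : Finset (Fin h) × Finset (Fin h) → ℂ) (Φ : Finset (Fin h) × Finset (Fin h) → Fin h → ℂ),
      (Matrix.of fun i j : Fin r => P2.p2Entry Θ Φ (w j) (u i)).det ≠ 0

variable {h : ℕ}

/-- A nonempty lower family of finsets contains `∅`. -/
theorem exists_eq_empty_of_lowerSet {r : ℕ} {u : Fin r → Finset (Fin h)} (hlu : IsLowerSet (Set.range u)) (i : Fin r) :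
    ∃ i', u i' = ∅ := by
  obtain ⟨i', hi'⟩ : (∅ : Finset (Fin h)) ∈ Set.range u := hlu (Finset.empty_subset (u i)) ⟨i, rfl⟩
  exact ⟨i', hi'⟩

/-- **The general form implies the node** (a nonempty simplicial complex contains `∅`; for `r = 0` the determinant is `1`). -/
theorem stub_conjZ_of_general (hZ : Stmt.conjZGeneral) : Stmt.stub_conjZ := by
  intro h r u w hu hw hlu hlw hNH
  rcases Nat.eq_zero_or_pos r with hr | hr
  · subst hr
    refine ⟨fun _ => 0, fun _ _ => 0, ?_⟩
    rw [Matrix.det_isEmpty]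
    exact one_ne_zero
  · exact hZ h r u w hu hw (exists_eq_empty_of_lowerSet hlu ⟨0, hr⟩) (exists_eq_empty_of_lowerSet hlw ⟨0, hr⟩) hNH

/-! ## 2. Z ⟹ profile-2 hit on nested-Hall pairs, either orientation (K1 + swap + mono) -/

/-- **Z ⟹ `symbolicDet 2 ≠ 0` on every lower pair satisfying nested Hall** (rows `u`, columns `w`), by K1 `P2.symbolicDet_two_ne_zero_of_p2Entry`. -/
theorem symbolicDet_two_ne_zero_of_conjZ (hZ : Stmt.stub_conjZ) {r : ℕ} (u w : Fin r → Finset (Fin h))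
    (hu : Function.Injective u) (hw : Function.Injective w) (hlu : IsLowerSet (Set.range u)) (hlw : IsLowerSet (Set.range w))
    (hNH : ∀ d : ℕ, 1 ≤ d →
      (Finset.univ.filter (fun j : Fin r => 2 * d - 1 ≤ (w j).card)).card ≤
        (Finset.univ.filter (fun i : Fin r => d ≤ (u i).card)).card) :
    symbolicDet 2 h r u w ≠ 0 := by
  obtain ⟨Θ, Φ, hdet⟩ := hZ h r u w hu hw hlu hlw hNH
  exact P2.symbolicDet_two_ne_zero_of_p2Entry Θ Φ u w hdet

/-- **Z ⟹ `symbolicDet 2 ≠ 0` when nested Hall holds in the SWAPPED orientation** (rows `w`, columns `u`), by `symbolicDet_ne_zero_comm`. -/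
theorem symbolicDet_two_ne_zero_of_conjZ_swap (hZ : Stmt.stub_conjZ) {r : ℕ} (u w : Fin r → Finset (Fin h))
    (hu : Function.Injective u) (hw : Function.Injective w) (hlu : IsLowerSet (Set.range u)) (hlw : IsLowerSet (Set.range w))
    (hNH : ∀ d : ℕ, 1 ≤ d →
      (Finset.univ.filter (fun i : Fin r => 2 * d - 1 ≤ (u i).card)).card ≤
        (Finset.univ.filter (fun j : Fin r => d ≤ (w j).card)).card) :
    symbolicDet 2 h r u w ≠ 0 :=
  (symbolicDet_ne_zero_comm 2 h r u w).mpr (symbolicDet_two_ne_zero_of_conjZ hZ w u hw hu hlw hlu hNH)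

/-- **Z at every profile `s ≥ 2`, either orientation** (`symbolicDet_ne_zero_mono`). -/
theorem symbolicDet_ne_zero_of_conjZ_orient (hZ : Stmt.stub_conjZ) {s r : ℕ} (hs : 2 ≤ s) (u w : Fin r → Finset (Fin h))
    (hu : Function.Injective u) (hw : Function.Injective w) (hlu : IsLowerSet (Set.range u)) (hlw : IsLowerSet (Set.range w))
    (hNH : (∀ d : ℕ, 1 ≤ d →
        (Finset.univ.filter (fun j : Fin r => 2 * d - 1 ≤ (w j).card)).card ≤
          (Finset.univ.filter (fun i : Fin r => d ≤ (u i).card)).card) ∨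
      (∀ d : ℕ, 1 ≤ d →
        (Finset.univ.filter (fun i : Fin r => 2 * d - 1 ≤ (u i).card)).card ≤
          (Finset.univ.filter (fun j : Fin r => d ≤ (w j).card)).card)) :
    symbolicDet s h r u w ≠ 0 := by
  rcases hNH with hNH | hNH
  · exact symbolicDet_ne_zero_mono hs (symbolicDet_two_ne_zero_of_conjZ hZ u w hu hw hlu hlw hNH)
  · exact symbolicDet_ne_zero_mono hs (symbolicDet_two_ne_zero_of_conjZ_swap hZ u w hu hw hlu hlw hNH)

/-! ## 3. The complement of Z inside the residual of record, and the glue -/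

/-- **STUB TEXT (offered, v27 candidate) `stub_ltRestNonCanonRSWZ` — THE REGISTERED RESIDUAL MINUS THE NESTED-HALL PAIRS.** The text of
`Stmt.stub_ltRestNonCanonRSW` (p691725, registered v26) VERBATIM with `2 ≤ s` in place of `1 ≤ s` and two further hypotheses: the profile-2 nested
Hall condition FAILS in both orientations. WEAKER than `Stmt.stub_ltRestNonCanonRSW` given Z (glue `stub_ltRestNonCanonRSW_of_conjZ_rswz`).
Honest content: the residual pairs that are INCOMMENSURABLE for the profile-2 dominant problem — both sides vertex-rich and deep (first explicit member
of the bare combinatorial class: `3300 × Δ⁹` versus `K₂₅₆^{(≤3)} + 579 484 tetrahedra`; whether it carries face-UQ data is open). WHY IT MIGHT FAIL: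
such a pair, data-free, LT-free, non-canonical, non-split, with no weighted apex split, whose symbolic minor vanishes at the chosen profile. -/
def Stmt.stub_ltRestNonCanonRSWZ : Prop :=
  ∃ s h₀ : ℕ, 2 ≤ s ∧ ∀ h : ℕ, h₀ ≤ h → ∀ (r : ℕ) (u w : Fin r → Finset (Fin h)),
    Function.Injective u → Function.Injective w → IsLowerSet (Set.range u) → IsLowerSet (Set.range w) → 2 ≤ r →
    (∀ (a : Fin h) (W₀ : Finset (Fin h)) (𝒜 : Finset (Finset (Fin h))) (ρ : Finset (Fin h) → Finset (Fin h)), ¬ UQFData s u w a W₀ 𝒜 ρ) →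
    (∀ (c : Fin h) (Z : Finset (Fin h)) (𝒜 : Finset (Finset (Fin h))) (ρ : Finset (Fin h) → Finset (Fin h)), ¬ UQFData s w u c Z 𝒜 ρ) →
    ¬ Summit.ValiantsHypothesis.ValiantsHypothesis.Theorems.BarrierLever.AnchoredPeeling.IsRelApexPair u w → ¬ Summit.ValiantsHypothesis.ValiantsHypothesis.Theorems.BarrierLever.AnchoredPeeling.IsRelApexPair w u → ¬ Summit.ValiantsHypothesis.ValiantsHypothesis.Theorems.BarrierLever.AnchoredPeeling.LTCert u w → ¬ Summit.ValiantsHypothesis.ValiantsHypothesis.Theorems.BarrierLever.AnchoredPeeling.LTCert w u →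
    (¬ ∃ (k : ℕ) (σ τ : Equiv.Perm (Fin h)), 1 ≤ k ∧ 2 * k + 1 ≤ h ∧ 2 ^ (k + 1) - 1 ≤ h ∧
        (∀ U : Finset (Fin h), U ∈ Set.range u ↔ Summit.ValiantsHypothesis.ValiantsHypothesis.Theorems.BarrierLever.AnchoredPeeling.DecRow k h (U.map σ.toEmbedding)) ∧
        (∀ W : Finset (Fin h), W ∈ Set.range w ↔ Summit.ValiantsHypothesis.ValiantsHypothesis.Theorems.BarrierLever.AnchoredPeeling.DecCol k h (W.map τ.toEmbedding))) →
    (¬ ∃ (k : ℕ) (σ τ : Equiv.Perm (Fin h)), 1 ≤ k ∧ 2 * k + 1 ≤ h ∧ 2 ^ (k + 1) - 1 ≤ h ∧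
        (∀ U : Finset (Fin h), U ∈ Set.range w ↔ Summit.ValiantsHypothesis.ValiantsHypothesis.Theorems.BarrierLever.AnchoredPeeling.DecRow k h (U.map σ.toEmbedding)) ∧
        (∀ W : Finset (Fin h), W ∈ Set.range u ↔ Summit.ValiantsHypothesis.ValiantsHypothesis.Theorems.BarrierLever.AnchoredPeeling.DecCol k h (W.map τ.toEmbedding))) →
    (¬ ∃ (m : ℕ) (σ τ : Equiv.Perm (Fin h)), 1 ≤ m ∧ 2 * m + 2 ≤ h ∧ 2 ^ (m + 1) + 2 ^ m - 1 ≤ h ∧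
        (∀ U : Finset (Fin h), U ∈ Set.range u ↔ Summit.ValiantsHypothesis.ValiantsHypothesis.Theorems.BarrierLever.AnchoredPeeling.SplitRow m h (U.map σ.toEmbedding)) ∧
        (∀ W : Finset (Fin h), W ∈ Set.range w ↔ Summit.ValiantsHypothesis.ValiantsHypothesis.Theorems.BarrierLever.AnchoredPeeling.SplitCol m h (W.map τ.toEmbedding))) →
    (¬ ∃ (m : ℕ) (σ τ : Equiv.Perm (Fin h)), 1 ≤ m ∧ 2 * m + 2 ≤ h ∧ 2 ^ (m + 1) + 2 ^ m - 1 ≤ h ∧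
        (∀ U : Finset (Fin h), U ∈ Set.range w ↔ Summit.ValiantsHypothesis.ValiantsHypothesis.Theorems.BarrierLever.AnchoredPeeling.SplitRow m h (U.map σ.toEmbedding)) ∧
        (∀ W : Finset (Fin h), W ∈ Set.range u ↔ Summit.ValiantsHypothesis.ValiantsHypothesis.Theorems.BarrierLever.AnchoredPeeling.SplitCol m h (W.map τ.toEmbedding))) →
    ¬ IsWApexPair u w → ¬ IsWApexPair w u →
    (¬ ∀ d : ℕ, 1 ≤ d →
      (Finset.univ.filter (fun j : Fin r => 2 * d - 1 ≤ (w j).card)).card ≤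
        (Finset.univ.filter (fun i : Fin r => d ≤ (u i).card)).card) →
    (¬ ∀ d : ℕ, 1 ≤ d →
      (Finset.univ.filter (fun i : Fin r => 2 * d - 1 ≤ (u i).card)).card ≤
        (Finset.univ.filter (fun j : Fin r => d ≤ (w j).card)).card) →
    symbolicDet s h r u w ≠ 0

/-- **GLUE (proved): Z + the residual minus nested-Hall pairs ⟹ the registered residual `stub_ltRestNonCanonRSW`.** Case split on nested Hall in
either orientation (Z at profile 2, lifted to `s ≥ 2` by `symbolicDet_ne_zero_mono`, swapped by `symbolicDet_ne_zero_comm`); otherwise the complement. -/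
theorem stub_ltRestNonCanonRSW_of_conjZ_rswz (hZ : Stmt.stub_conjZ) (hR : Stmt.stub_ltRestNonCanonRSWZ) : Stmt.stub_ltRestNonCanonRSW := by
  obtain ⟨s, h₀, hs, H⟩ := hR
  refine ⟨s, h₀, le_trans (by norm_num) hs, ?_⟩
  intro h hh r u w hu hw hlu hlw hr hA hB hRA hRB hLA hLB hc hc' hd hd' hwa hwb
  by_cases hNH : ∀ d : ℕ, 1 ≤ d →
      (Finset.univ.filter (fun j : Fin r => 2 * d - 1 ≤ (w j).card)).card ≤
        (Finset.univ.filter (fun i : Fin r => d ≤ (u i).card)).card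
  · exact symbolicDet_ne_zero_of_conjZ_orient hZ hs u w hu hw hlu hlw (Or.inl hNH)
  · by_cases hNH' : ∀ d : ℕ, 1 ≤ d →
        (Finset.univ.filter (fun i : Fin r => 2 * d - 1 ≤ (u i).card)).card ≤
          (Finset.univ.filter (fun j : Fin r => d ≤ (w j).card)).card
    · exact symbolicDet_ne_zero_of_conjZ_orient hZ hs u w hu hw hlu hlw (Or.inr hNH')
    · exact H h hh r u w hu hw hlu hlw hr hA hB hRA hRB hLA hLB hc hc' hd hd' hwa hwb hNH hNH'

/-! ## 4. The Theorems-side chain from the residual of record to the route decl (the skeleton's v22/v23 glue, SP and DC being theorems) -/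

/-- **SP up to relabelling** (the skeleton's `splitFamily_relab`, from the THEOREM `stub_splitFamily` p686283 and `symbolicDet_ne_zero_relab_iff` p654443). -/
theorem splitFamily_relab' (m h r : ℕ) (u w : Fin r → Finset (Fin h)) (σ τ : Equiv.Perm (Fin h))
    (hm : 1 ≤ m) (h1 : 2 * m + 2 ≤ h) (h2 : 2 ^ (m + 1) + 2 ^ m - 1 ≤ h) (hu : Function.Injective u) (hw : Function.Injective w)
    (hU : ∀ U : Finset (Fin h), U ∈ Set.range u ↔ SplitRow m h (U.map σ.toEmbedding))
    (hW : ∀ W : Finset (Fin h), W ∈ Set.range w ↔ SplitCol m h (W.map τ.toEmbedding)) :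
    symbolicDet 1 h r u w ≠ 0 := by
  rw [← symbolicDet_ne_zero_relab_iff σ τ]
  have hpreσ : ∀ U : Finset (Fin h), (U.map σ.symm.toEmbedding).map σ.toEmbedding = U := by
    intro U; rw [Finset.map_map]; convert Finset.map_refl (s := U) using 2; ext x; simp
  have hpreτ : ∀ W : Finset (Fin h), (W.map τ.symm.toEmbedding).map τ.toEmbedding = W := by
    intro W; rw [Finset.map_map]; convert Finset.map_refl (s := W) using 2; ext x; simp
  refine stub_splitFamily m h r _ _ hm h1 h2 (fun i i' hii => hu (Finset.map_injective _ hii)) (fun j j' hjj => hw (Finset.map_injective _ hjj))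
    (fun U => ?_) (fun W => ?_)
  · constructor
    · rintro ⟨i, rfl⟩
      exact (hU (u i)).1 ⟨i, rfl⟩
    · intro hD
      obtain ⟨i, hi⟩ := (hU (U.map σ.symm.toEmbedding)).2 (by rw [hpreσ]; exact hD)
      exact ⟨i, by show (u i).map σ.toEmbedding = U; rw [hi, hpreσ]⟩
  · constructor
    · rintro ⟨j, rfl⟩
      exact (hW (w j)).1 ⟨j, rfl⟩
    · intro hD
      obtain ⟨j, hj⟩ := (hW (W.map τ.symm.toEmbedding)).2 (by rw [hpreτ]; exact hD)
      exact ⟨j, by show (w j).map τ.toEmbedding = W; rw [hj, hpreτ]⟩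

/-- **The residual of record (v23–v25 text) ⟹ THE LT REST** (`Stmt.stub_ltRest`, p645437): the four relabelled exclusions are THEOREMS at profile 1
(split pairs by `splitFamily_relab'`, canonical pairs by `symbolicDet_one_ne_zero_decFamily_relab`), lifted to profile `s` by `symbolicDet_ne_zero_mono`
and swapped by `symbolicDet_ne_zero_comm`. (The skeleton's `stub_ltRestNonCanonR_of_sp_rs` ∘ `stub_ltRest_of_nonCanonR`, Theorems-side.) -/
theorem stub_ltRest_of_ltRestNonCanonRS (hN : Stmt.stub_ltRestNonCanonRS) : Stmt.stub_ltRest := by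
  obtain ⟨s, h₀, hs, H⟩ := hN
  refine ⟨s, h₀, hs, ?_⟩
  intro h hh r u w hu hw hlu hlw hr hA hB hRA hRB hLA hLB
  by_cases hc : ∃ (k : ℕ) (σ τ : Equiv.Perm (Fin h)), 1 ≤ k ∧ 2 * k + 1 ≤ h ∧ 2 ^ (k + 1) - 1 ≤ h ∧
      (∀ U : Finset (Fin h), U ∈ Set.range u ↔ DecRow k h (U.map σ.toEmbedding)) ∧
      (∀ W : Finset (Fin h), W ∈ Set.range w ↔ DecCol k h (W.map τ.toEmbedding))
  · obtain ⟨k, σ, τ, hk, h1, h2, hU, hW⟩ := hc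
    exact symbolicDet_ne_zero_mono hs (symbolicDet_one_ne_zero_decFamily_relab k h r u w σ τ hk h1 h2 hw hU hW)
  by_cases hc' : ∃ (k : ℕ) (σ τ : Equiv.Perm (Fin h)), 1 ≤ k ∧ 2 * k + 1 ≤ h ∧ 2 ^ (k + 1) - 1 ≤ h ∧
      (∀ U : Finset (Fin h), U ∈ Set.range w ↔ DecRow k h (U.map σ.toEmbedding)) ∧
      (∀ W : Finset (Fin h), W ∈ Set.range u ↔ DecCol k h (W.map τ.toEmbedding))
  · obtain ⟨k, σ, τ, hk, h1, h2, hU, hW⟩ := hc'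
    exact (symbolicDet_ne_zero_comm s h r u w).2
      (symbolicDet_ne_zero_mono hs (symbolicDet_one_ne_zero_decFamily_relab k h r w u σ τ hk h1 h2 hu hU hW))
  by_cases hd : ∃ (m : ℕ) (σ τ : Equiv.Perm (Fin h)), 1 ≤ m ∧ 2 * m + 2 ≤ h ∧ 2 ^ (m + 1) + 2 ^ m - 1 ≤ h ∧
      (∀ U : Finset (Fin h), U ∈ Set.range u ↔ SplitRow m h (U.map σ.toEmbedding)) ∧
      (∀ W : Finset (Fin h), W ∈ Set.range w ↔ SplitCol m h (W.map τ.toEmbedding))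
  · obtain ⟨m, σ, τ, hm, h1, h2, hU, hW⟩ := hd
    exact symbolicDet_ne_zero_mono hs (splitFamily_relab' m h r u w σ τ hm h1 h2 hu hw hU hW)
  by_cases hd' : ∃ (m : ℕ) (σ τ : Equiv.Perm (Fin h)), 1 ≤ m ∧ 2 * m + 2 ≤ h ∧ 2 ^ (m + 1) + 2 ^ m - 1 ≤ h ∧
      (∀ U : Finset (Fin h), U ∈ Set.range w ↔ SplitRow m h (U.map σ.toEmbedding)) ∧
      (∀ W : Finset (Fin h), W ∈ Set.range u ↔ SplitCol m h (W.map τ.toEmbedding))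
  · obtain ⟨m, σ, τ, hm, h1, h2, hU, hW⟩ := hd'
    exact (symbolicDet_ne_zero_comm s h r u w).2
      (symbolicDet_ne_zero_mono hs (splitFamily_relab' m h r w u σ τ hm h1 h2 hw hu hU hW))
  exact H h hh r u w hu hw hlu hlw hr hA hB hRA hRB hLA hLB hc hc' hd hd'

/-- **Composition BY NAME: the residual of record `Stmt.stub_ltRestNonCanonRS` ⟹ the support item `AnchoredDoorHitsLowerPairs`.** -/
theorem anchoredDoorHitsLowerPairs_of_ltRestNonCanonRS (hN : Stmt.stub_ltRestNonCanonRS) :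
    Summit.ValiantsHypothesis.ValiantsHypothesis.Theses.BarrierLever.AnchoredDoorHitsLowerPairs :=
  anchoredDoorHitsLowerPairs_of_ltRest (stub_ltRest_of_ltRestNonCanonRS hN)

/-- **Composition BY NAME: the REGISTERED residual `Stmt.stub_ltRestNonCanonRSW` (v26) ⟹ the support item** (through p691725's `stub_ltRestNonCanonRS_of_rsw`). -/
theorem anchoredDoorHitsLowerPairs_of_ltRestNonCanonRSW (hW : Stmt.stub_ltRestNonCanonRSW) :
    Summit.ValiantsHypothesis.ValiantsHypothesis.Theses.BarrierLever.AnchoredDoorHitsLowerPairs :=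
  anchoredDoorHitsLowerPairs_of_ltRestNonCanonRS (stub_ltRestNonCanonRS_of_rsw hW)

/-- **COMPOSITION BY NAME (the glued pair): CONJECTURE Z + the residual minus nested-Hall pairs ⟹ the support item `AnchoredDoorHitsLowerPairs`.** -/
theorem anchoredDoorHitsLowerPairs_of_conjZ_rswz (hZ : Stmt.stub_conjZ) (hR : Stmt.stub_ltRestNonCanonRSWZ) :
    Summit.ValiantsHypothesis.ValiantsHypothesis.Theses.BarrierLever.AnchoredDoorHitsLowerPairs :=
  anchoredDoorHitsLowerPairs_of_ltRestNonCanonRSW (stub_ltRestNonCanonRSW_of_conjZ_rswz hZ hR)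

/-- The general Z-door form serves as well. -/
theorem anchoredDoorHitsLowerPairs_of_conjZGeneral_rswz (hZ : Stmt.conjZGeneral) (hR : Stmt.stub_ltRestNonCanonRSWZ) :
    Summit.ValiantsHypothesis.ValiantsHypothesis.Theses.BarrierLever.AnchoredDoorHitsLowerPairs :=
  anchoredDoorHitsLowerPairs_of_conjZ_rswz (stub_conjZ_of_general hZ) hR

/-! ## 5. The bare combinatorial complement: move+thin residual minus nested-Hall pairs -/

/-- **STUB TEXT (offered) `stub_moveThinRestZ` — THE MOVE+THIN RESIDUAL MINUS THE NESTED-HALL PAIRS.** The text of `Stmt.stub_moveThinResidual` (p623393)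
with `2 ≤ s` and two further hypotheses: the profile-2 nested Hall condition fails in both orientations. Its class is purely combinatorial: injective lower
pairs with `r ≥ 2`, no star(`s`) step, no gap-one move and no thin vertex on either side, INCOMMENSURABLE for the profile-2 dominant problem both ways.
First explicit member of the thin-free, star(2)-free, doubly non-nested-Hall class: `3300 × Δ⁹` versus `K₂₅₆^{(≤3)} + 579 484 tetrahedra` (memo g26 §1).
WEAKER than `Stmt.stub_moveThinResidual` given Z (glue `stub_moveThinResidual_of_conjZ_restZ`). -/
def Stmt.stub_moveThinRestZ : Prop :=
  ∃ s : ℕ, 2 ≤ s ∧ ∀ (h r : ℕ) (u w : Fin r → Finset (Fin h)), Function.Injective u → Function.Injective w →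
    IsLowerSet (Set.range u) → IsLowerSet (Set.range w) → 2 ≤ r →
    (¬ ∃ Z W : Finset (Fin h), Z ∈ Set.range u ∧ W ∈ Set.range w ∧ 1 ≤ Z.card ∧ 1 ≤ W.card ∧ (Z.card ≤ s ∨ W.card ≤ s) ∧
        (Finset.univ.filter (fun i => Z ⊆ u i)).card = (Finset.univ.filter (fun j => W ⊆ w j)).card) →
    (¬ ∃ (a c : Fin h) (D : Finset (Fin h)), c ∉ D ∧ (insert c D).card ≤ s ∧
        Fintype.card {i : Fin r // ¬ (a ∈ u i)} = Fintype.card {j : Fin r // ¬ (insert c D ⊆ w j)} + 1) →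
    (¬ ∃ (c a : Fin h) (B : Finset (Fin h)), a ∉ B ∧ (insert a B).card ≤ s ∧
        Fintype.card {j : Fin r // ¬ (c ∈ w j)} = Fintype.card {i : Fin r // ¬ (insert a B ⊆ u i)} + 1) →
    (¬ ∃ a : Fin h, (∃ i, a ∈ u i) ∧ (Finset.univ.filter (fun i => a ∈ u i)).card ≤ (Finset.univ.filter (fun c : Fin h => ∃ j, w j = {c})).card) →
    (¬ ∃ c : Fin h, (∃ j, c ∈ w j) ∧ (Finset.univ.filter (fun j => c ∈ w j)).card ≤ (Finset.univ.filter (fun a : Fin h => ∃ i, u i = {a})).card) →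
    (¬ ∀ d : ℕ, 1 ≤ d →
      (Finset.univ.filter (fun j : Fin r => 2 * d - 1 ≤ (w j).card)).card ≤
        (Finset.univ.filter (fun i : Fin r => d ≤ (u i).card)).card) →
    (¬ ∀ d : ℕ, 1 ≤ d →
      (Finset.univ.filter (fun i : Fin r => 2 * d - 1 ≤ (u i).card)).card ≤
        (Finset.univ.filter (fun j : Fin r => d ≤ (w j).card)).card) →
    symbolicDet s h r u w ≠ 0

/-- **GLUE (proved): Z + the move+thin residual minus nested-Hall pairs ⟹ the move+thin residual** (`Stmt.stub_moveThinResidual`). -/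
theorem stub_moveThinResidual_of_conjZ_restZ (hZ : Stmt.stub_conjZ) (hR : Stmt.stub_moveThinRestZ) : Stmt.stub_moveThinResidual := by
  obtain ⟨s, hs, H⟩ := hR
  refine ⟨s, le_trans (by norm_num) hs, ?_⟩
  intro h r u w hu hw hlu hlw hr hstar hgx hgy htx hty
  by_cases hNH : ∀ d : ℕ, 1 ≤ d →
      (Finset.univ.filter (fun j : Fin r => 2 * d - 1 ≤ (w j).card)).card ≤
        (Finset.univ.filter (fun i : Fin r => d ≤ (u i).card)).card
  · exact symbolicDet_ne_zero_of_conjZ_orient hZ hs u w hu hw hlu hlw (Or.inl hNH)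
  · by_cases hNH' : ∀ d : ℕ, 1 ≤ d →
        (Finset.univ.filter (fun i : Fin r => 2 * d - 1 ≤ (u i).card)).card ≤
          (Finset.univ.filter (fun j : Fin r => d ≤ (w j).card)).card
    · exact symbolicDet_ne_zero_of_conjZ_orient hZ hs u w hu hw hlu hlw (Or.inr hNH')
    · exact H h r u w hu hw hlu hlw hr hstar hgx hgy htx hty hNH hNH'

/-- **COMPOSITION BY NAME: Z + the move+thin residual minus nested-Hall pairs ⟹ the support item** (through p623393's landed kernel induction
`anchoredDoorHitsLowerPairs_of_moveThinResidual`: base, star steps, gap-one moves, thin vertex steps, residual). -/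
theorem anchoredDoorHitsLowerPairs_of_conjZ_moveThinRestZ (hZ : Stmt.stub_conjZ) (hR : Stmt.stub_moveThinRestZ) :
    Summit.ValiantsHypothesis.ValiantsHypothesis.Theses.BarrierLever.AnchoredDoorHitsLowerPairs :=
  anchoredDoorHitsLowerPairs_of_moveThinResidual (stub_moveThinResidual_of_conjZ_restZ hZ hR)

end

end Summit.ValiantsHypothesis.ValiantsHypothesis.Theorems.BarrierLever.AnchoredPeeling
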